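import Literature.MathematicalPhysics.QuantumFieldTheory.Balaban1983to89.Node00.Record12Residuals

/-!
# NODE 00 (YM-PLAN Track A) — STAGE 12, FILE 12c′: THE LEVEL-1 𝐓-IMAGE SLOTS OF RECORD DO NOT VANISH at the fluctuation factor of record —
# the χ-weighted resummation of the T-step slots IS the transport of `ρ₀` (pointwise), and its non-degeneracy on every torus with `K ≥ 1`

Cell `pub-ymgap`, NODE 00, K0′-components seat `pub-ymgap-node00-def-K0b` (g0), answering dag-ref-H's PROBE-ZT-ONE ask (pub-ymgap INBOX l.13563, (b):
«some level-1 slot ≠ 0 at your ζ (unity + 𝐓ρ₀ > 0)»), the guard under which K1′'s (B) conjunct is contentful at the K0′ parameter (director-ym LINE №104).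
[III] = [Balaban1988Convergent] (journal page = PDF page + 242).

WHAT THIS FILE PROVES (kernel bookkeeping of print's resummation p. 267 ∕ p. 270: *«each term in (3.1) has been written as a sum of terms of the same type …
We represent this sum as a sum over admissible domains»*):
* §1 `sum_chi_mul_wOfRecord_eq_one` — THE POINTWISE RESUMMATION LAW of n02-b's step weights `wOfRecord A₁ ζ` under the ζ-unity law: for every old sequence `s`
  and EVERY pair of fields `(U, V′)`, `Σ_{s′ : init s′ = s} χ_{k+1}(s′)(V′) · w(s′)(U, V′) = 1` (FILE 2's `IsStepUnity` is its trace on the graph `V′ = Ū`, weighted by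
  `χ_k(s)`; here off the graph, from n02-b's label-level unity `labelUnity_ωOfRecord` by the fibrewise resummation over the index map `σOfRecord`).
  `wOfRecord_eq_zero_of_forall_ne` ∕ `slotsTOfRecord_succ_eq_zero_of_forall_ne` — ABSENT sequences (outside the image of `σOfRecord`) weigh `0` and their
  𝐓-image slot is the zero density (bearing of 12b's `SlotsNondegenerate` over `Set.range ppSel`: at the identity selector it quantifies over absent sequences).
* §2 `trhoOfRecord9_zero_eq_transport` — THE LEVEL-1 IDENTITY: the assembled 𝐓-image density of record `𝐓ρ₀ = Σ_{s′} χ₁(s′)·slotT₁(s′)` (FILE 2's `trhoOfRecord9 … 0`)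
  EQUALS the one-step kernel transport of `ρ₀` (`transportOfRecord … 0 ρ₀`) POINTWISE, for any step weights with the two ζ-laws whose `U`-sections are
  measurable (hypothesis `hw`; no joint measurability, no (O4) clause); `exists_transportOfRecord_rhoZero_pos` — on a torus with `K ≥ 1` the transport of
  `ρ₀ > 0` is positive somewhere (the marginal density of Bałaban's averaging of record integrates to `1`); hence **`exists_slotsTOfRecord_one_ne_zero`**: SOME
  level-1 pre-𝐑 slot of record is non-zero ON ITS OWN χ₁-SUPPORT — the 𝐓-image family at level 1 is not the zero family, so the zero branch of 12b's dichotomy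
  (`HasSect2FormAtZ`) cannot discharge `TLaw₁₂ θ p 0` wholesale.
* §3 AT THE FLUCTUATION FACTOR OF RECORD `zeta316OfRecord` (FILE 12c): the `U`-sections of its step weights ARE measurable (`measurable_wOfRecord_zeta316_section`:
  at FIXED `V′` the one-cube backgrounds `V^{(k)}_{□′}(V′)` are constants, so every (3.3)∕(3.16) event is `{U | dist1 (U(b)·g⁻¹) < δ}` — `RegularGaugeGroup.measurable_dist1`,
  no choice-map regularity needed), whence the hypothesis-free forms `trhoOfRecord9_zero_eq_transport_zeta316`, `exists_slotsTOfRecord_one_ne_zero_zeta316`, and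
  AT A STAGE-12 PARAMETER carrying the residuals of record (`Stage12Params.HasResidualsOfRecord`): `tdensOfRecord₁₀_zero_eq_transport_of_hasResidualsOfRecord`,
  **`exists_slotT_one_ne_zero_of_hasResidualsOfRecord`** (every run `p` with `1 ≤ p.K`).

* §4 (v1.1) `slotsNondegenerate_iff_of_toStage9Params_eq` ∕ `slotsNondegenerate_of_extension` — 12b's `SlotsNondegenerate` reads only the Stage-9 part of `θ`
  (bearing on the K0′ skeleton's rung B, which asks it of every base tuple).

HONEST SCOPE.  Finite resummation + Bochner linearity on the (probability) averaging kernel + `ρ₀ > 0`; nothing of Bałaban's estimates; the POST-𝐑 family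
(`slotsOfRecord … 1`, def-R's (0.3) R-step of these slots; 12b's `SlotsNondegenerate`) is NOT treated here.  Counts unmoved (typed 28∕28 · discharged 5∕28); not a
discharge; one finite torus at fixed `ε = L^{−K}` — not continuum ∕ OS ∕ mass-gap ∕ Clay.  No `sorry`, no `axiom`, no `instance`, no `notation`.
-/

noncomputable section

open MeasureTheory ProbabilityTheory
open scoped BigOperators Matrix.Norms.L2Operator

namespace Literature.MathematicalPhysics.QuantumFieldTheory.Balaban1983to89.Node00

open T4NestedCovariance T4AdjointCovariance T4AveragingDisintegration T4Continuum T4FiniteEpsInhabited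
open B15DeterminingSets B14.Eq213DetSet B14.Eq216Concrete B14.Eq213MaximalDomains B15Eq112TorusCover B14DomainGeom
open B14.Sect3Decomp B14.Eq316 B14.Eq218Concrete
open Tk

/-! ## §1  The pointwise resummation law of the step weights of record -/

section Resum

variable (F : T4Family) (N : ℕ) [NeZero N] (ν : Stage7Numerics) (M : ℕ) (A₁ : ℝ)

open Classical in
/-- **POINTWISE RESUMMATION LAW**: under the ζ-unity law, for every old sequence `s` and every `(U, V′)`,
`Σ_{s′ : init s′ = s} χ_{k+1}(s′)(V′) · w(s′)(U, V′) = 1` (fibrewise over n02-b's index map, then `labelUnity_ωOfRecord`).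
[cite: Balaban1988Convergent, (3.2)–(3.5) p.265, (3.16) p.268, (3.20) p.269, §3 p.267] -/
theorem sum_chi_mul_wOfRecord_eq_one {ζ : ZetaOfRecord F N ν M} (hζ : IsZetaUnity F N ν M ζ) (p : B12.RunParams) (g : ℕ → ℝ) (k : ℕ)
    (s : SeqOfRecord F ν M g p.K k) (U : GaugeField (F.P p.K) k (SU N)) (V' : GaugeField (F.P p.K) (k + 1) (SU N)) :
    ∑ s' ∈ Finset.univ.filter (fun s' : SeqOfRecord F ν M g p.K (k + 1) => s'.init = s),
        chiSeqOfRecord F N ν M g p.K (k + 1) s' V' * wOfRecord F N ν M A₁ ζ p g k s' U V' = 1 := by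
  classical
  have key : ∀ s' ∈ Finset.univ.filter (fun s' : SeqOfRecord F ν M g p.K (k + 1) => s'.init = s),
      chiSeqOfRecord F N ν M g p.K (k + 1) s' V' * wOfRecord F N ν M A₁ ζ p g k s' U V'
        = ∑ t ∈ Finset.univ.filter (fun t : LbOfRecord F ν p g k => σOfRecord F ν M p g k s t = s'),
            chiSeqOfRecord F N ν M g p.K (k + 1) (σOfRecord F ν M p g k s t) V' * ωOfRecord F N ν M p g k A₁ ζ s t U V' := by
    intro s' hs'
    have hs : s'.init = s := (Finset.mem_filter.1 hs').2
    rw [wOfRecord_apply, resumWeights, hs, Finset.mul_sum]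
    refine Finset.sum_congr rfl (fun t ht => ?_)
    rw [(Finset.mem_filter.1 ht).2]
  rw [Finset.sum_congr rfl key]
  exact (Finset.sum_fiberwise_of_maps_to (t := Finset.univ.filter (fun s' : SeqOfRecord F ν M g p.K (k + 1) => s'.init = s))
      (g := σOfRecord F ν M p g k s)
      (f := fun t => chiSeqOfRecord F N ν M g p.K (k + 1) (σOfRecord F ν M p g k s t) V' * ωOfRecord F N ν M p g k A₁ ζ s t U V')
      (fun t _ => by simp [init_σOfRecord])).trans
    (labelUnity_ωOfRecord F N ν M p g k A₁ hζ s U V')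

/-- … at `k = 0` every length-1 sequence extends THE length-0 sequence, so the law reads `Σ_{s′} χ₁(s′)(V′) · w(s′)(U, V′) = 1` over ALL `s′`.
[cite: Balaban1988Convergent, §3 p.267, Thm 1 p.262 (bookkeeping)] -/
theorem sum_chi_mul_wOfRecord_zero_eq_one {ζ : ZetaOfRecord F N ν M} (hζ : IsZetaUnity F N ν M ζ) (p : B12.RunParams) (g : ℕ → ℝ)
    (U : GaugeField (F.P p.K) 0 (SU N)) (V' : GaugeField (F.P p.K) 1 (SU N)) :
    ∑ s' : SeqOfRecord F ν M g p.K 1, chiSeqOfRecord F N ν M g p.K 1 s' V' * wOfRecord F N ν M A₁ ζ p g 0 s' U V' = 1 := by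
  classical
  have h := sum_chi_mul_wOfRecord_eq_one F N ν M A₁ hζ p g 0 (Seq.zero _) U V'
  rwa [Finset.filter_true_of_mem (fun s' _ => Seq.eq_zero s'.init)] at h


open Classical in
/-- **ABSENT SEQUENCES WEIGH ZERO**: a length-`(k+1)` sequence OUTSIDE the image of n02-b's index map `σOfRecord … s′.init ·` (print: a pair `(Ω_{k+1}, Λ_{k+1})`
no label `(P, Q, R, S)` produces — an ABSENT term of (2.17)∕(2.18)) carries the step weight `0` (empty resummation), for EVERY ζ.
[cite: Balaban1988Convergent, (3.5) p.265, (3.20) p.269, §3 p.267, (2.17) p.257] -/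
theorem wOfRecord_eq_zero_of_forall_ne (ζ : ZetaOfRecord F N ν M) (p : B12.RunParams) (g : ℕ → ℝ) (k : ℕ)
    (s' : SeqOfRecord F ν M g p.K (k + 1)) (h : ∀ t : LbOfRecord F ν p g k, σOfRecord F ν M p g k s'.init t ≠ s')
    (U : GaugeField (F.P p.K) k (SU N)) (V' : GaugeField (F.P p.K) (k + 1) (SU N)) :
    wOfRecord F N ν M A₁ ζ p g k s' U V' = 0 := by
  classical
  rw [wOfRecord_apply, resumWeights]
  exact Finset.sum_eq_zero fun t ht => absurd (Finset.mem_filter.1 ht).2 (h t)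

/-- **… HENCE THEIR 𝐓-IMAGE SLOT IS THE ZERO DENSITY** (the transport of the zero integrand), for EVERY ζ, `E`, selector: the pre-𝐑 slot family of record is
supported on the IMAGE of the index map — the «present» sequences of print.  (Bearing of 12b's `SlotsNondegenerate`, which quantifies over `Set.range ppSel`: at
the identity selector it asks non-vanishing at absent sequences too.) [cite: Balaban1988Convergent, (2.17)–(2.18) p.257, (3.24)–(3.25) p.270; Balaban1989LargeFieldI, (0.3) p.176] -/
theorem slotsTOfRecord_succ_eq_zero_of_forall_ne (τ : TowerNumerics) (ζ : ZetaOfRecord F N ν τ.M) (E : B12.RunParams → ℝ) (ppSel : PpSelOfRecord F ν τ.M)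
    (p : B12.RunParams) (g : ℕ → ℝ) (k : ℕ) (s' : SeqOfRecord F ν τ.M g p.K (k + 1))
    (h : ∀ t : LbOfRecord F ν p g k, σOfRecord F ν τ.M p g k s'.init t ≠ s') :
    slotsTOfRecord F N ν τ E (wOfRecord F N ν τ.M A₁ ζ) ppSel p g (k + 1) s' = 0 := by
  funext V'
  show (avgDensity (avOfRecord F N p.K k).avg V' : ℝ) *
      ∫ U, wOfRecord F N ν τ.M A₁ ζ p g k s' U V' *
        (chiSeqOfRecord F N ν τ.M g p.K k s'.init U * slotsOfRecord F N ν τ E (wOfRecord F N ν τ.M A₁ ζ) ppSel p g k s'.init U)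
        ∂(avgKernel (avOfRecord F N p.K k).avg V') = 0
  simp only [wOfRecord_eq_zero_of_forall_ne F N ν τ.M A₁ ζ p g k s' h, zero_mul, integral_zero, mul_zero]

end Resum

/-! ## §2  The level-1 identity `𝐓ρ₀ = transport ρ₀` and the non-degeneracy of the 𝐓-image slot family -/

section LevelOne

variable (F : T4Family) (N : ℕ) [NeZero N] (ν : Stage7Numerics) (τ : TowerNumerics) (A₁ : ℝ)

/-- `ρ₀` of record is bounded by `e^{−E}` (the Wilson–Boltzmann weight is `≤ 1` at `β = g₀⁻² ≥ 0`). [cite: Balaban1988Convergent, Thm 1 p.262 (bookkeeping)] -/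
theorem rhoZeroOfRecord_le (K : ℕ) (g₀ E : ℝ) (U : GaugeField (F.P K) 0 (SU N)) : rhoZeroOfRecord F N K g₀ E U ≤ Real.exp (-E) := by
  unfold rhoZeroOfRecord
  exact mul_le_of_le_one_right (Real.exp_pos _).le (Missing.boltzmann_le_one (F.P K) (sq_nonneg _) U)

/-- `ρ₀` of record is measurable (`reTr` is measurable on `SU(N)`). [cite: Balaban1988Convergent, Thm 1 p.262 (bookkeeping)] -/
theorem measurable_rhoZeroOfRecord (K : ℕ) (g₀ E : ℝ) : Measurable (rhoZeroOfRecord F N K g₀ E) := by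
  unfold rhoZeroOfRecord
  exact measurable_const.mul (Missing.measurable_boltzmann RegularGaugeGroup.measurable_reTr (F.P K) _)

/-- **THE LEVEL-1 IDENTITY `𝐓ρ₀ = transport ρ₀`, POINTWISE**: for step weights `wOfRecord A₁ ζ` with the two ζ-laws and measurable `U`-sections, FILE 2's
assembled 𝐓-image density at level 1, `Σ_{s′} χ₁(s′)(V′)·slotT₁(s′)(V′)`, IS the kernel transport of `ρ₀` at `V′` (the finite sum passes the fibre integral by
Bochner linearity — each piece is bounded and measurable against the probability kernel — and the weights resum to `1`). [cite: Balaban1988Convergent, (3.1) p.264, §3 p.267, (3.24)–(3.25) p.270] -/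
theorem trhoOfRecord9_zero_eq_transport {ζ : ZetaOfRecord F N ν τ.M} (hζ : IsZetaUnity F N ν τ.M ζ) (hζ' : IsZetaAbsLeOne F N ν τ.M ζ)
    (E : B12.RunParams → ℝ) (ppSel : PpSelOfRecord F ν τ.M) (p : B12.RunParams) (g : ℕ → ℝ)
    (hw : ∀ (s' : SeqOfRecord F ν τ.M g p.K 1) (V' : GaugeField (F.P p.K) 1 (SU N)),
      Measurable (fun U : GaugeField (F.P p.K) 0 (SU N) => wOfRecord F N ν τ.M A₁ ζ p g 0 s' U V'))
    (V' : GaugeField (F.P p.K) 1 (SU N)) :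
    trhoOfRecord9 F N ν τ E (wOfRecord F N ν τ.M A₁ ζ) ppSel p g 0 V' =
      transportOfRecord F N p.K 0 (rhoZeroOfRecord F N p.K (g 0) (E p)) V' := by
  classical
  set w := wOfRecord F N ν τ.M A₁ ζ with hwdef
  set ρ₀ := rhoZeroOfRecord F N p.K (g 0) (E p) with hρ₀
  set κ := avgKernel (avOfRecord F N p.K 0).avg V' with hκ
  set h : ℝ := (avgDensity (avOfRecord F N p.K 0).avg V' : ℝ) with hh
  -- unfold the assembled density and each T-step slot
  have hslot : ∀ s' : SeqOfRecord F ν τ.M g p.K 1,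
      slotsTOfRecord F N ν τ E w ppSel p g 1 s' V' =
        h * ∫ U, w p g 0 s' U V' * (chiSeqOfRecord F N ν τ.M g p.K 0 s'.init U * ρ₀ U) ∂κ := fun s' => rfl
  have hlhs : trhoOfRecord9 F N ν τ E w ppSel p g 0 V' =
      ∑ s' : SeqOfRecord F ν τ.M g p.K 1, chiSeqOfRecord F N ν τ.M g p.K 1 s' V' * slotsTOfRecord F N ν τ E w ppSel p g 1 s' V' := rfl
  have hrhs : transportOfRecord F N p.K 0 ρ₀ V' = h * ∫ U, ρ₀ U ∂κ := rfl
  rw [hlhs, hrhs]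
  simp_rw [hslot, chiSeqOfRecord_zero, one_mul]
  -- each piece is integrable against the probability kernel
  have hint : ∀ s' : SeqOfRecord F ν τ.M g p.K 1,
      Integrable (fun U => chiSeqOfRecord F N ν τ.M g p.K 1 s' V' * (w p g 0 s' U V' * ρ₀ U)) κ := by
    intro s'
    have hm : Measurable (fun U => chiSeqOfRecord F N ν τ.M g p.K 1 s' V' * (w p g 0 s' U V' * ρ₀ U)) :=
      measurable_const.mul ((hw s' V').mul (measurable_rhoZeroOfRecord F N p.K (g 0) (E p)))
    refine (integrable_const (Real.exp (-(E p)))).mono' hm.aestronglyMeasurable (Filter.Eventually.of_forall fun U => ?_)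
    rw [Real.norm_eq_abs, abs_mul, abs_mul]
    have h1 : |chiSeqOfRecord F N ν τ.M g p.K 1 s' V'| ≤ 1 := abs_chiSeqOfRecord_le_one F N ν τ.M g p.K 1 s' V'
    have h2 : |w p g 0 s' U V'| ≤ 1 := abs_wOfRecord_le_one F N ν τ.M A₁ hζ' p g 0 s' U V'
    have h3 : |ρ₀ U| ≤ Real.exp (-(E p)) := by
      rw [abs_of_pos (rhoZeroOfRecord_pos F N p.K (g 0) (E p) U)]
      exact rhoZeroOfRecord_le F N p.K (g 0) (E p) U
    calc |chiSeqOfRecord F N ν τ.M g p.K 1 s' V'| * (|w p g 0 s' U V'| * |ρ₀ U|)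
        ≤ 1 * (1 * Real.exp (-(E p))) := by
          gcongr
    _ = Real.exp (-(E p)) := by ring
  calc ∑ s' : SeqOfRecord F ν τ.M g p.K 1,
        chiSeqOfRecord F N ν τ.M g p.K 1 s' V' * (h * ∫ U, w p g 0 s' U V' * ρ₀ U ∂κ)
      = h * ∑ s' : SeqOfRecord F ν τ.M g p.K 1,
          ∫ U, chiSeqOfRecord F N ν τ.M g p.K 1 s' V' * (w p g 0 s' U V' * ρ₀ U) ∂κ := by
        rw [Finset.mul_sum]
        refine Finset.sum_congr rfl fun s' _ => ?_
        rw [integral_const_mul]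
        ring
    _ = h * ∫ U, ∑ s' : SeqOfRecord F ν τ.M g p.K 1, chiSeqOfRecord F N ν τ.M g p.K 1 s' V' * (w p g 0 s' U V' * ρ₀ U) ∂κ := by
        rw [integral_finsetSum _ fun s' _ => hint s']
    _ = h * ∫ U, ρ₀ U ∂κ := by
        congr 1
        refine integral_congr_ae (Filter.Eventually.of_forall fun U => ?_)
        have hsum := sum_chi_mul_wOfRecord_zero_eq_one F N ν τ.M A₁ hζ p g U V'
        calc ∑ s' : SeqOfRecord F ν τ.M g p.K 1, chiSeqOfRecord F N ν τ.M g p.K 1 s' V' * (w p g 0 s' U V' * ρ₀ U)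
            = (∑ s' : SeqOfRecord F ν τ.M g p.K 1, chiSeqOfRecord F N ν τ.M g p.K 1 s' V' * w p g 0 s' U V') * ρ₀ U := by
              rw [Finset.sum_mul]
              exact Finset.sum_congr rfl fun s' _ => by ring
          _ = ρ₀ U := by rw [hsum, one_mul]

/-- **ON A TORUS WITH `K ≥ 1` THE TRANSPORT OF `ρ₀` IS POSITIVE SOMEWHERE**: the marginal density of the averaging of record integrates to `1` against `dV′`
(`HaarAC` at `0 < K`), so it is positive at some `V′`; there the transport is the positive marginal density times the kernel average of `ρ₀ > 0`.
[cite: Balaban1988Convergent, (3.1) p.264; Balaban1987RG1, (0.4) p.253 (bookkeeping)] -/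
theorem exists_transportOfRecord_rhoZero_pos (p : B12.RunParams) (hK : 0 < p.K) (g₀ E : ℝ) :
    ∃ V' : GaugeField (F.P p.K) 1 (SU N), 0 < transportOfRecord F N p.K 0 (rhoZeroOfRecord F N p.K g₀ E) V' := by
  classical
  set avg := (avOfRecord F N p.K 0).avg with havg
  haveI : IsProbabilityMeasure (fieldMeasure (F.P p.K) 0 (SU N)) := Missing.isProbabilityMeasure_fieldMeasure (F.P p.K) 0
  haveI : IsProbabilityMeasure (fieldMeasure (F.P p.K) 1 (SU N)) := Missing.isProbabilityMeasure_fieldMeasure (F.P p.K) 1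
  have hmeas : Measurable avg := avOfRecord_measurable F N p.K 0
  have hac : (fieldMeasure (F.P p.K) 0 (SU N)).map avg ≪ fieldMeasure (F.P p.K) 1 (SU N) := avOfRecord_haarAC F N p.K 0 hK
  -- the marginal density is not identically zero
  have hne : ∃ V', avgDensity avg V' ≠ 0 := by
    by_contra hzero
    push Not at hzero
    have hwd := withDensity_margDensity (fieldMeasure (F.P p.K) 0 (SU N)) (fieldMeasure (F.P p.K) 1 (SU N)) hmeas hac
    have h0 : (fieldMeasure (F.P p.K) 1 (SU N)).withDensity (fun V => (avgDensity avg V : ENNReal)) = 0 := by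
      rw [show (fun V => (avgDensity avg V : ENNReal)) = 0 from funext fun V => by simp [hzero V], withDensity_zero]
    have h1 : ((fieldMeasure (F.P p.K) 0 (SU N)).map avg) Set.univ = 1 := by
      rw [Measure.map_apply hmeas MeasurableSet.univ, Set.preimage_univ, measure_univ]
    rw [← hwd, h0] at h1
    simp at h1
  obtain ⟨V', hV'⟩ := hne
  refine ⟨V', ?_⟩
  have hpos : 0 < (avgDensity avg V' : ℝ) := lt_of_le_of_ne (avgDensity avg V').coe_nonneg (fun h => hV' (by exact_mod_cast h.symm))
  have hint : 0 < ∫ U, rhoZeroOfRecord F N p.K g₀ E U ∂(avgKernel avg V') := by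
    have hI : Integrable (rhoZeroOfRecord F N p.K g₀ E) (avgKernel avg V') :=
      (integrable_const (Real.exp (-E))).mono' (measurable_rhoZeroOfRecord F N p.K g₀ E).aestronglyMeasurable
        (Filter.Eventually.of_forall fun U => by
          rw [Real.norm_eq_abs, abs_of_pos (rhoZeroOfRecord_pos F N p.K g₀ E U)]
          exact rhoZeroOfRecord_le F N p.K g₀ E U)
    rw [integral_pos_iff_support_of_nonneg (fun U => (rhoZeroOfRecord_pos F N p.K g₀ E U).le) hI]
    have hsupp : Function.support (rhoZeroOfRecord F N p.K g₀ E) = Set.univ :=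
      Set.eq_univ_of_forall fun U => (rhoZeroOfRecord_pos F N p.K g₀ E U).ne'
    rw [hsupp, measure_univ]
    exact one_pos
  exact mul_pos hpos hint

/-- **NON-DEGENERACY OF THE LEVEL-1 𝐓-IMAGE SLOT FAMILY**: on a torus with `K ≥ 1`, for step weights `wOfRecord A₁ ζ` with the two ζ-laws and measurable
`U`-sections, SOME pre-𝐑 slot of record at level 1 is non-zero at a point OF ITS OWN χ₁-SUPPORT. [cite: Balaban1988Convergent, (3.1) p.264, §3 p.267, (3.24)–(3.25) p.270] -/
theorem exists_slotsTOfRecord_one_ne_zero {ζ : ZetaOfRecord F N ν τ.M} (hζ : IsZetaUnity F N ν τ.M ζ) (hζ' : IsZetaAbsLeOne F N ν τ.M ζ)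
    (E : B12.RunParams → ℝ) (ppSel : PpSelOfRecord F ν τ.M) (p : B12.RunParams) (hK : 0 < p.K) (g : ℕ → ℝ)
    (hw : ∀ (s' : SeqOfRecord F ν τ.M g p.K 1) (V' : GaugeField (F.P p.K) 1 (SU N)),
      Measurable (fun U : GaugeField (F.P p.K) 0 (SU N) => wOfRecord F N ν τ.M A₁ ζ p g 0 s' U V')) :
    ∃ (s' : SeqOfRecord F ν τ.M g p.K 1) (V' : GaugeField (F.P p.K) 1 (SU N)),
      chiSeqOfRecord F N ν τ.M g p.K 1 s' V' ≠ 0 ∧ slotsTOfRecord F N ν τ E (wOfRecord F N ν τ.M A₁ ζ) ppSel p g 1 s' V' ≠ 0 := by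
  classical
  obtain ⟨V', hV'⟩ := exists_transportOfRecord_rhoZero_pos F N p hK (g 0) (E p)
  have hid := trhoOfRecord9_zero_eq_transport F N ν τ A₁ hζ hζ' E ppSel p g hw V'
  have hlhs : trhoOfRecord9 F N ν τ E (wOfRecord F N ν τ.M A₁ ζ) ppSel p g 0 V' =
      ∑ s' : SeqOfRecord F ν τ.M g p.K 1, chiSeqOfRecord F N ν τ.M g p.K 1 s' V' *
        slotsTOfRecord F N ν τ E (wOfRecord F N ν τ.M A₁ ζ) ppSel p g 1 s' V' := rfl
  by_contra hnone
  push Not at hnone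
  have hzero : ∑ s' : SeqOfRecord F ν τ.M g p.K 1, chiSeqOfRecord F N ν τ.M g p.K 1 s' V' *
      slotsTOfRecord F N ν τ E (wOfRecord F N ν τ.M A₁ ζ) ppSel p g 1 s' V' = 0 := by
    refine Finset.sum_eq_zero fun s' _ => ?_
    by_cases hc : chiSeqOfRecord F N ν τ.M g p.K 1 s' V' = 0
    · rw [hc, zero_mul]
    · rw [hnone s' V' hc, mul_zero]
  rw [hlhs, hzero] at hid
  exact (ne_of_gt hV') hid.symm

end LevelOne

/-! ## §3  At the fluctuation factor of record: measurable `U`-sections, and the hypothesis-free forms -/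

section Sections

variable {F : T4Family} {N : ℕ} [NeZero N] {ν : Stage7Numerics} {M : ℕ} {p : B12.RunParams} {g : ℕ → ℝ} {k : ℕ}

/-- AT A FIXED COARSE FIELD `V′` the (3.3)∕(3.16) event of the cube `□′` at threshold `δ` is a MEASURABLE set of fine fields `U`: the one-cube background
`V^{(k)}_{□′}(V′)` is then a constant, and the event is `⋂_{b} {U | dist1 (U(b)·V^{(k)}_{□′}(b)⁻¹) < δ}` (`RegularGaugeGroup.measurable_dist1` on `SU(N)`).
[cite: Balaban1988Convergent, (3.3) p.265, (3.16) p.268 (bookkeeping)] -/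
theorem measurableSet_smallApproxFluct_section (s : SeqOfRecord F ν M g p.K k) (δ : ℝ) (V' : GaugeField (F.P p.K) (k + 1) (SU N)) (c : Iχ F ν p g k) :
    MeasurableSet {U : GaugeField (F.P p.K) k (SU N) |
      SmallApproxFluct (sect3DataOfRecord F N ν M p g k s) (avOfRecord F N p.K) δ U V' c} := by
  classical
  have hset : {U : GaugeField (F.P p.K) k (SU N) | SmallApproxFluct (sect3DataOfRecord F N ν M p g k s) (avOfRecord F N p.K) δ U V' c} =
      ⋂ b ∈ (sect3DataOfRecord F N ν M p g k s).bondsStar c,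
        {U : GaugeField (F.P p.K) k (SU N) |
          dist1 (U b * (Vbox (sect3DataOfRecord F N ν M p g k s) (avOfRecord F N p.K) c V' b)⁻¹) < δ} := by
    ext U
    simp only [SmallApproxFluct, Set.mem_setOf_eq, Set.mem_iInter]
  rw [hset]
  refine Finset.measurableSet_biInter _ fun b _ => ?_
  have hm : Measurable (fun U : GaugeField (F.P p.K) k (SU N) =>
      dist1 (U b * (Vbox (sect3DataOfRecord F N ν M p g k s) (avOfRecord F N p.K) c V' b)⁻¹)) :=
    RegularGaugeGroup.measurable_dist1.comp ((Missing.measurable_eval b).mul_const _)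
  exact measurableSet_lt hm measurable_const

/-- The `U`-section of n02-b's (3.3) label weight `b(P, Q)(·, V′)` is measurable. [cite: Balaban1988Convergent, (3.3) p.265 (bookkeeping)] -/
theorem measurable_bWeight_section (A₁ : ℝ) (s : SeqOfRecord F ν M g p.K k) (Pl Ql : Finset (Iχ F ν p g k))
    (V' : GaugeField (F.P p.K) (k + 1) (SU N)) :
    Measurable (fun U : GaugeField (F.P p.K) k (SU N) => bWeight F N ν M p g k A₁ s Pl Ql U V') := by
  classical
  unfold bWeight
  by_cases hQ : Ql ⊆ qcubes F ν M p g k s Pl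
  · simp only [if_pos hQ]
    refine Measurable.mul ?_ ?_
    · unfold chiPrime
      exact Finset.measurable_prod _ fun c _ =>
        Measurable.ite (measurableSet_smallApproxFluct_section s _ V' c) measurable_const measurable_const
    · unfold chiPrimec
      exact Finset.measurable_prod _ fun c _ =>
        Measurable.ite (measurableSet_smallApproxFluct_section s _ V' c) measurable_const measurable_const
  · simp only [if_neg hQ]
    exact measurable_const

/-- The `U`-section of the fluctuation factor of record `ζ_{k+1}(R, S)(·, V′)` is measurable. [cite: Balaban1988Convergent, (3.16) p.268 (bookkeeping)] -/
theorem measurable_zeta316OfRecord_section (A₁ : ℝ) (s : SeqOfRecord F ν M g p.K k) (Pl Ql : Finset (Iχ F ν p g k))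
    (RS : Finset (Iχ F ν p g k) × Finset (Iχ F ν p g k)) (V' : GaugeField (F.P p.K) (k + 1) (SU N)) :
    Measurable (fun U : GaugeField (F.P p.K) k (SU N) => zeta316OfRecord F N ν M A₁ p g k s Pl Ql RS U V') := by
  classical
  have hev : ∀ c : Iχ F ν p g k, MeasurableSet {U : GaugeField (F.P p.K) k (SU N) |
      SmallFluct (bonds316 F N ν M p g k s) (fluctSize316 F N ν M p g k s U V') (deltaOfRecord ν g k A₁) c} := by
    intro c
    have hset : {U : GaugeField (F.P p.K) k (SU N) |
        SmallFluct (bonds316 F N ν M p g k s) (fluctSize316 F N ν M p g k s U V') (deltaOfRecord ν g k A₁) c} =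
        {U | SmallApproxFluct (sect3DataOfRecord F N ν M p g k s) (avOfRecord F N p.K) (deltaOfRecord ν g k A₁) U V' c} := by
      ext U
      exact smallFluct_bonds316_iff s U V' _ c
    rw [hset]
    exact measurableSet_smallApproxFluct_section s _ V' c
  by_cases hc : RS.1 ⊆ cubes316 F ν M p g k s Pl Ql ∧ RS.2 = RS.1
  · simp only [zeta316OfRecord, if_pos hc]
    refine Measurable.mul ?_ ?_
    · unfold chiK
      exact Finset.measurable_prod _ fun c _ => Measurable.ite (hev c) measurable_const measurable_const
    · unfold chiKc
      exact Finset.measurable_prod _ fun c _ => Measurable.ite (hev c) measurable_const measurable_const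
  · simp only [zeta316OfRecord, if_neg hc]
    exact measurable_const

/-- The `U`-section of the label weight `ω s t (·, V′)` at the fluctuation factor of record is measurable (the (3.2) factor `a(P)(V′)` is a constant there).
[cite: Balaban1988Convergent, (3.2)–(3.3) p.265, (3.16) p.268 (bookkeeping)] -/
theorem measurable_ωOfRecord_zeta316_section (A₁ : ℝ) (s : SeqOfRecord F ν M g p.K k) (t : LbOfRecord F ν p g k)
    (V' : GaugeField (F.P p.K) (k + 1) (SU N)) :
    Measurable (fun U : GaugeField (F.P p.K) k (SU N) => ωOfRecord F N ν M p g k A₁ (zeta316OfRecord F N ν M A₁) s t U V') := by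
  unfold ωOfRecord
  exact (measurable_const.mul (measurable_bWeight_section A₁ s t.1 t.2.1 V')).mul
    (measurable_zeta316OfRecord_section A₁ s t.1 t.2.1 t.2.2 V')

/-- **THE `U`-SECTIONS OF THE STEP WEIGHTS OF RECORD ARE MEASURABLE** at the fluctuation factor of record (a finite sum of measurable label weights).
[cite: Balaban1988Convergent, §3 p.267 (bookkeeping)] -/
theorem measurable_wOfRecord_zeta316_section (A₁ : ℝ) (s' : SeqOfRecord F ν M g p.K (k + 1)) (V' : GaugeField (F.P p.K) (k + 1) (SU N)) :
    Measurable (fun U : GaugeField (F.P p.K) k (SU N) => wOfRecord F N ν M A₁ (zeta316OfRecord F N ν M A₁) p g k s' U V') := by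
  classical
  simp only [wOfRecord_apply, resumWeights]
  exact Finset.measurable_sum _ fun t _ => measurable_ωOfRecord_zeta316_section A₁ s'.init t V'

end Sections

section OfRecord

variable (F : T4Family) (N : ℕ) [NeZero N] (ν : Stage7Numerics) (τ : TowerNumerics) (A₁ : ℝ)

/-- **`𝐓ρ₀ = transport ρ₀` AT THE FLUCTUATION FACTOR OF RECORD**, hypothesis-free (every run, every history, every `V′`).
[cite: Balaban1988Convergent, (3.1) p.264, §3 p.267, (3.25) p.270] -/
theorem trhoOfRecord9_zero_eq_transport_zeta316 (E : B12.RunParams → ℝ) (ppSel : PpSelOfRecord F ν τ.M) (p : B12.RunParams) (g : ℕ → ℝ)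
    (V' : GaugeField (F.P p.K) 1 (SU N)) :
    trhoOfRecord9 F N ν τ E (wOfRecord F N ν τ.M A₁ (zeta316OfRecord F N ν τ.M A₁)) ppSel p g 0 V' =
      transportOfRecord F N p.K 0 (rhoZeroOfRecord F N p.K (g 0) (E p)) V' :=
  trhoOfRecord9_zero_eq_transport F N ν τ A₁ (isZetaUnity_zeta316OfRecord A₁) (isZetaAbsLeOne_zeta316OfRecord A₁) E ppSel p g
    (fun s' V' => measurable_wOfRecord_zeta316_section A₁ s' V') V'

/-- **SOME LEVEL-1 𝐓-IMAGE SLOT OF RECORD IS NON-ZERO ON ITS χ₁-SUPPORT AT THE FLUCTUATION FACTOR OF RECORD**, on every torus with `K ≥ 1` (any selector, any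
constants, any history). [cite: Balaban1988Convergent, (3.1) p.264, §3 p.267, (3.24)–(3.25) p.270] -/
theorem exists_slotsTOfRecord_one_ne_zero_zeta316 (E : B12.RunParams → ℝ) (ppSel : PpSelOfRecord F ν τ.M) (p : B12.RunParams) (hK : 0 < p.K)
    (g : ℕ → ℝ) :
    ∃ (s' : SeqOfRecord F ν τ.M g p.K 1) (V' : GaugeField (F.P p.K) 1 (SU N)),
      chiSeqOfRecord F N ν τ.M g p.K 1 s' V' ≠ 0 ∧
        slotsTOfRecord F N ν τ E (wOfRecord F N ν τ.M A₁ (zeta316OfRecord F N ν τ.M A₁)) ppSel p g 1 s' V' ≠ 0 :=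
  exists_slotsTOfRecord_one_ne_zero F N ν τ A₁ (isZetaUnity_zeta316OfRecord A₁) (isZetaAbsLeOne_zeta316OfRecord A₁) E ppSel p hK g
    fun s' V' => measurable_wOfRecord_zeta316_section A₁ s' V'

variable {F N}

/-- **AT A STAGE-12 PARAMETER CARRYING THE RESIDUALS OF RECORD: `𝐓ρ₀` of record (12b's `tdensOfRecord₁₀ … 0`) IS the transport of `ρ₀`**, pointwise, every run.
[cite: Balaban1988Convergent, (3.1) p.264, (3.25) p.270] -/
theorem tdensOfRecord₁₀_zero_eq_transport_of_hasResidualsOfRecord {θ : Stage12Params F N} (h : θ.HasResidualsOfRecord F N) (p : B12.RunParams)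
    (V' : GaugeField (F.P p.K) 1 (SU N)) :
    tdensOfRecord₁₀ F N θ.toStage9Params p 0 V' =
      transportOfRecord F N p.K 0 (rhoZeroOfRecord F N p.K (gOfRecord₁₀ F N θ.toStage9Params p 0) (EOfRecord₁₀ F N θ.toStage9Params p)) V' := by
  have hζ : θ.ζ = zeta316OfRecord F N θ.ν θ.τ9.M θ.A₁ := h.zeta_eq
  show trhoOfRecord9 F N θ.ν θ.τ9 (EOfRecord₁₀ F N θ.toStage9Params) (wOfRecord F N θ.ν θ.τ9.M θ.A₁ θ.ζ) θ.ppSel p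
      (gOfRecord₁₀ F N θ.toStage9Params p) 0 V' = _
  rw [hζ]
  exact trhoOfRecord9_zero_eq_transport_zeta316 F N θ.ν θ.τ9 θ.A₁ _ θ.ppSel p _ V'

/-- **AT A STAGE-12 PARAMETER CARRYING THE RESIDUALS OF RECORD, SOME LEVEL-1 𝐓-IMAGE SLOT OF RECORD IS NON-ZERO ON ITS χ₁-SUPPORT** on every run with `K ≥ 1` —
the non-degeneracy dag-ref-H's PROBE-ZT-ONE asked for: the zero branch of 12b's dichotomy does not discharge `TLaw₁₂ θ p 0` wholesale at the K0′ parameter.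
[cite: Balaban1988Convergent, (3.1) p.264, §3 p.267, (3.24)–(3.25) p.270] -/
theorem exists_slotT_one_ne_zero_of_hasResidualsOfRecord {θ : Stage12Params F N} (h : θ.HasResidualsOfRecord F N) (p : B12.RunParams) (hK : 0 < p.K) :
    ∃ (s' : SeqOfRecord F θ.ν θ.τ9.M (gOfRecord₁₀ F N θ.toStage9Params p) p.K 1) (V' : GaugeField (F.P p.K) 1 (SU N)),
      chiSeqOfRecord F N θ.ν θ.τ9.M (gOfRecord₁₀ F N θ.toStage9Params p) p.K 1 s' V' ≠ 0 ∧
        slotsTOfRecord F N θ.ν θ.τ9 (EOfRecord₁₀ F N θ.toStage9Params) (wOfRecord₉ F N θ.toStage9Params) θ.ppSel p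
          (gOfRecord₁₀ F N θ.toStage9Params p) 1 s' V' ≠ 0 := by
  have hζ : θ.ζ = zeta316OfRecord F N θ.ν θ.τ9.M θ.A₁ := h.zeta_eq
  show ∃ s' V', _ ∧ slotsTOfRecord F N θ.ν θ.τ9 (EOfRecord₁₀ F N θ.toStage9Params) (wOfRecord F N θ.ν θ.τ9.M θ.A₁ θ.ζ) θ.ppSel p
      (gOfRecord₁₀ F N θ.toStage9Params p) 1 s' V' ≠ 0
  rw [hζ]
  exact exists_slotsTOfRecord_one_ne_zero_zeta316 F N θ.ν θ.τ9 θ.A₁ _ θ.ppSel p hK _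

end OfRecord

/-! ## §4  (v1.1) `SlotsNondegenerate` is a property of the STAGE-9 PART (bearing on the K0′ skeleton's rung B) -/

section Stage9Part

variable {F : T4Family} {N : ℕ} [NeZero N]

/-- **12b's `SlotsNondegenerate` READS ONLY THE STAGE-9 PART of a Stage-12 parameter** (`ν`, `τ9`, `ppSel`, `A₁`, `ζ`, the Stage-8 letters of `E` and `g`): two
Stage-12 parameters with the same Stage-9 part are slot-non-degenerate together.  Bearing (pub-ymgap, K0′ skeleton `K0Skeleton12` rung B `BgExtend12`: «every admissible
base tuple `θ′` EXTENDS to a `θ` with `θ.toStage9Params = θ′ ∧ … ∧ θ.SlotsNondegenerate`»): the extension cannot help — rung B asks `SlotsNondegenerate` of EVERY base tuple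
(in particular of those whose selector's range contains absent sequences, §1), so the conjunct belongs with the CHOICE of the base tuple (rung A).
[cite: Balaban1988Convergent, (2.17)–(2.18) p.257; Balaban1989LargeFieldI, (0.3) p.176 (bookkeeping)] -/
theorem slotsNondegenerate_iff_of_toStage9Params_eq {θ₁ θ₂ : Stage12Params F N} (h : θ₁.toStage9Params = θ₂.toStage9Params) :
    θ₁.SlotsNondegenerate ↔ θ₂.SlotsNondegenerate := by
  unfold Stage12Params.SlotsNondegenerate
  rw [h]

/-- … so along rung B of the skeleton (`θ.toStage9Params = θ′`) the conjunct `θ.SlotsNondegenerate` is decided by `θ′` alone: it holds for ONE extension iff it holds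
for EVERY extension (e.g. for the extension with K0b's residuals `RzOfRecord`, `ZtOfRecord` and any §2 numerics). [cite: Balaban1988Convergent, (2.18) p.257 (bookkeeping)] -/
theorem slotsNondegenerate_of_extension {θ' : Stage9Params F N} {θ₁ θ₂ : Stage12Params F N} (h₁ : θ₁.toStage9Params = θ') (h₂ : θ₂.toStage9Params = θ')
    (hnd : θ₁.SlotsNondegenerate) : θ₂.SlotsNondegenerate :=
  (slotsNondegenerate_iff_of_toStage9Params_eq (h₁.trans h₂.symm)).mp hnd

end Stage9Part

end Literature.MathematicalPhysics.QuantumFieldTheory.Balaban1983to89.Node00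

end
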